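import Summits.BirchSwinnertonDyer.BirchSwinnertonDyer.Theorems.ByReductionTypeAtTwoKatoFreeSandwichAssembly
import Summits.BirchSwinnertonDyer.BirchSwinnertonDyer.Theses.ByReductionTypeAtTwo
import Summits.BirchSwinnertonDyer.BirchSwinnertonDyer.Theses.TwoAdicConverse
import HarnessLib

/-!
# Crux `OrdMissingLowerBoundAtTwo` (stmt-BirchSwinnertonDyer-19577, K4 `ByReductionTypeAtTwo`, rank 203) —
# line `kato-free-lower-sandwich-two`: TURNKEY CERTIFICATE for the pen (lead g3, 2026-08-28)

BSD is not proved by any of this; 19577 is NOT closed by this file.  This is a CRUX WORKFILE (scratch, elaborates on the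
farm, no `sorry`), not a Theorems proposal: it compiles, against the CURRENT tree, the two declarations a 19573-style TURNKEY
package (RC-328/RC-329 pattern) would add to the K4 route file for 19577, and proves the glue BY NAME from the landed assembly
p668589 `KatoFreeSandwich.ordMissingLowerBoundAtTwo_of_published_of_lambdaHalf`.

WHY A PACKAGE IS NEEDED.  The route decl `Theses.ByReductionTypeAtTwo.OrdMissingLowerBoundAtTwo` is UNCONDITIONAL (a
`∀`-statement over {non-CM, analytic rank 0, good ordinary at 2}); the line delivers it only from PUB (19149) ∧ Cassels (first
conjunct of 19567) ∧ Abbes–Ullmo ∧ the `X₁(N)`-optimal datum T2 ∧ the λ-half 19556 — the first four are cite-level named facts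
that are never proved in the route.  So even when crux 19556 `OrdLambdaHalfAtTwo` closes, item 19577 cannot close `proved` from
this line AS FILED («stub_lambdaHalf closes by name when 19556 closes» removes one sorry of the skeleton, not the other two).
Exactly as for 19573 (RC-328), the consumable deliverable is the CONDITIONAL door, and the route needs ONE glue support item whose
statement threads the printed inputs as displayed hypotheses:

* support (PRINT by name) `OrdMLBPrintedInputsAtTwo := abbesUllmo_not_dvd_maninConstant_of_not_dvd_level ∧
  exists_optimal_gamma1ParametrizationData` (Abbes–Ullmo 1996 Thm A; Stevens 1989 §2 / Conrad–Edixhoven–Stein 2003 §6.1);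
* glue support `OrdMissingLowerBoundAtTwoOfInputs := OrdPublishedInputsAtTwo → OrdIsoPublishedInputsAtTwo →
  OrdMLBPrintedInputsAtTwo → TwoAdicConverse.OrdLambdaHalfAtTwo → OrdMissingLowerBoundAtTwo` — CLOSABLE AT ONCE
  (`ordMissingLowerBoundAtTwoOfInputs_closes` below, one line over p668589);
* `closes` rewired: `hOrdL := hOrdGlue hOrdPub hOrdPubI hOrdPr hΛ` with `hΛ : TwoAdicConverse.OrdLambdaHalfAtTwo` = crux 19556
  BY NAME (already a K4-visible decl: the route file can import `Theses.TwoAdicConverse`, or the pen spells the body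
  `Theorems.TwoAdicTwistConverse.OrdLambdaHalfAtTwo` as it did for r208); 19577 stays an item (direct proof claimable, low priority).

Both `def`s below are written EXACTLY as the pen would paste them into the route file (modulo the `@[route_item]` attribute and
the namespace); the theorem is the certificate that the glue closes by name today.  Nothing here is a Literature fact, nothing is
proposed; the defs are local to this workfile's namespace.
-/

set_option autoImplicit false
set_option linter.dupNamespace false

noncomputable section

namespace Summit.BirchSwinnertonDyer.BirchSwinnertonDyer.Cruxes.OrdMissingLowerBoundAtTwo.KatoFreeLowerSandwichTwo.Turnkey

open Literature.NumberTheory.EllipticCurves.ModularForms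
open Summit.BirchSwinnertonDyer.BirchSwinnertonDyer.Theses

/-- PROPOSED support item (PRINT, by name; never proved in the route): the two printed inputs of the line beyond PUB/Cassels —
Abbes–Ullmo 1996 Thm A (`c₀` prime to every `p ∤ N`) and the existence of the `X₁(N)`-optimal curve/datum of an
`X₀(N)`-optimal class (Stevens 1989 §2; Conrad–Edixhoven–Stein 2003 §6.1), both existing Literature named facts. -/
def OrdMLBPrintedInputsAtTwo : Prop :=
  abbesUllmo_not_dvd_maninConstant_of_not_dvd_level ∧ exists_optimal_gamma1ParametrizationData

/-- PROPOSED glue support item: crux 19577 from PUB (19149), the isogeny rider (19567), the printed inputs above and the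
λ-half crux 19556 of route `TwoAdicConverse`, all BY NAME. -/
def OrdMissingLowerBoundAtTwoOfInputs : Prop :=
  ByReductionTypeAtTwo.OrdPublishedInputsAtTwo → ByReductionTypeAtTwo.OrdIsoPublishedInputsAtTwo →
    OrdMLBPrintedInputsAtTwo → TwoAdicConverse.OrdLambdaHalfAtTwo → ByReductionTypeAtTwo.OrdMissingLowerBoundAtTwo

/-- CERTIFICATE: the proposed glue closes AT ONCE, by the landed assembly of the line
(`KatoFreeSandwich.ordMissingLowerBoundAtTwo_of_published_of_lambdaHalf`, p668589). -/
theorem ordMissingLowerBoundAtTwoOfInputs_closes : OrdMissingLowerBoundAtTwoOfInputs :=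
  fun hPub hPubI hPr hΛ =>
    Summit.BirchSwinnertonDyer.BirchSwinnertonDyer.Theorems.KatoFreeSandwich.ordMissingLowerBoundAtTwo_of_published_of_lambdaHalf
      hPub hPubI.1 hPr.1 hPr.2 hΛ

/-- The same certificate with the glue's hypotheses displayed one by one (the shape of the rewired `closes` binder `hOrdL`). -/
theorem ordMissingLowerBoundAtTwo_of_inputs
    (hOrdPub : ByReductionTypeAtTwo.OrdPublishedInputsAtTwo) (hOrdPubI : ByReductionTypeAtTwo.OrdIsoPublishedInputsAtTwo)
    (hOrdPr : OrdMLBPrintedInputsAtTwo) (hΛ : TwoAdicConverse.OrdLambdaHalfAtTwo) :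
    ByReductionTypeAtTwo.OrdMissingLowerBoundAtTwo :=
  ordMissingLowerBoundAtTwoOfInputs_closes hOrdPub hOrdPubI hOrdPr hΛ

end Summit.BirchSwinnertonDyer.BirchSwinnertonDyer.Cruxes.OrdMissingLowerBoundAtTwo.KatoFreeLowerSandwichTwo.Turnkey

end
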